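import Literature.NumberTheory.ComplexMultiplication.MainTheoremCMLevelPairTransport
import Literature.NumberTheory.ComplexMultiplication.MainTheoremCMLevelUniformizationTransport
import HarnessLib

/-!
# Main theorem of complex multiplication — the relative polarisation clause for `A₀ / L` from the MODEL `A₀ ⊗_L L₁`

[Shimura1998] G. Shimura, *Abelian Varieties with Complex Multiplication and Modular Functions*, Princeton 1998,
§18.6, proof of Thm. 18.6: p. 165 («we may assume that `A`, `A_i`, `ι`, `η_i` are rational over an algebraic number
field»), pp. 128–130 («`E_ℓ(κ⁻¹(X^σ)) = E_ℓ(pX)` … `X^σ` corresponds to `pζ` with respect to `ξ*`»), p. 169 («put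
`ξ′ = ξ* ∘ Φ(g(d))`»).

Topic: piece G11b of row II-1 S7a `levelStructure` (cell `hodgecm-mathlib`, D-0151) INSTANTIATED for the assembly
G12: the last conjunct of the junction predicate `IsLevelUniformization` (`MainTheoremCMLevelUniformization`) for the
ORIGINAL structure `(A₀ / L, ξ on A₀ ⊗ ℂ, σ ∈ Aut ℂ)` is derived from S5
(`CMPolarisationFrobeniusTransport.weilPairingLevel_uniformization_conjugate_eq_pow`) run on the model `A₀ ⊗_L L₁`
over a common number field `L₁ ⊇ L` (`γ = σ|_{L₁}` an arithmetic Frobenius, `κ : A₁ → A₁^γ` with `κ̃ = F` from G10),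
by the transports of `MainTheoremCMLevelPairTransport` along the tower isomorphism `T` and along `E = e₁ ≫ T^σ`
(`MainTheoremCMLevelUniformizationTransport`), in the points currency `E ∘ κ_ℂ` on `ξ₁ = T⁻¹ ∘ ξ` of
`MainTheoremCMLevelKappaPoints`.  One theorem; no definition, no instance, no named fact.  All model-side
projections, the uniformisation `ξ* = E⁻¹ ∘ ξ₂` and the `[ℓᵏ]`-dominances are discharged inside.
HC_CM is proved only modulo the printed citations until rung 0 closes.
-/

/-! ### The PAIR conjunct of `IsLevelUniformization` for the ORIGINAL `A₀ / L` from S5 run on the MODEL `A₀ ⊗_L L₁` -/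

noncomputable section

open CategoryTheory CategoryTheory.Limits AlgebraicGeometry NumberField IsDedekindDomain
open scoped NumberField nonZeroDivisors
open Literature.AlgebraicGeometry.Motives Literature.AlgebraicGeometry.Motives.AbelianVariety
open Literature.AlgebraicGeometry.Motives.AbelianVariety.GoodReductionAt

namespace Literature.NumberTheory.ComplexMultiplication

open FractionalIdeal (spanSingleton)

/-- **The relative polarisation clause of `IsLevelUniformization` for `(A₀ / L, ξ, σ)` from Shimura's step
«`E_ℓ(κ⁻¹(X^σ)) = E_ℓ(pX)`» run on the MODEL `A₀ ⊗_L L₁` over a bigger number field `L₁ ⊆ ℂ`** (p. 165 «we may assume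
… rational over an algebraic number field», pp. 128–130, p. 169 «put `ξ′ = ξ* ∘ Φ(g(d))`»).  Inputs: the junction's
data (`X`, `π_A`, `ξ` of type `𝔞` on `A₀ ⊗ ℂ`, `σ ∈ Aut ℂ`, `π_σ`, `ℓ`, `ξ′` of type `𝔟` on `(A₀ ⊗ ℂ)^σ`); on the model
`A₁ = A₀ ⊗_L L₁`: `γ ∈ Aut(L₁/F₀)` with `σ|_{L₁} = γ`, an arithmetic Frobenius at `v` (`q = pⁿ`), the reduction data
`R`, `Hγ` towards the canonical `conjFrob`, `κ : A₁ → A₁^γ` with `κ̃ = F` (G10), `v ∤ ℓ`, the Galois block (G) on `L̄₁`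
at all `ℓ`-power levels (F-S5c: `σ̃`, (σ-a), (σ-b), (2′) through p604665); the uniformisation `ξ₁ = T⁻¹ ∘ ξ` of
`A₁ ⊗ ℂ` (`exists_tower_source`, `T` the tower isomorphism); a uniformisation `ξ₂` of the junction carrier
`(A₀ ⊗ ℂ)^σ` of type `𝔠` with «`κ ∘ ξ₁ = ξ₂`» read through `E = e₁ ≫ T^σ`
(`e₁ = conjugateBaseChangeAlongIso γ σ hσ A₁`; Shimura's `ξ*` read on `A^σ`; the currency of
`MainTheoremCMLevelKappaPoints`), and the reindex `𝔠 = β𝔟`, `ξ′(w) = ξ₂(βw)` (G11a).  Inside: `ξ* = E⁻¹ ∘ ξ₂ =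
κ_ℂ ∘ ξ₁` (`exists_iso_conjugate_baseChange_tower`, `ofIso`).  Conclusion: the last conjunct of
`IsLevelUniformization Φ 𝔞 𝔟 A₀ ι₀ X πA ξ σ s πσ ℓ N ξ′ q β ν` verbatim (`q = pⁿ`, spelled as the caller
likes, e.g. `Ideal.absNorm 𝔭`), i.e. the `hPAIR` input of `MainTheoremCMLevelStructureOfParts` after `fun β ξ′ h𝔠 hξ′`.  Proof: S5
(`weilPairingLevel_uniformization_conjugate_eq_pow`) on the model at every level `ℓᵏ`, moved to `A₀ ⊗ ℂ` along `T`
(`weilPairingLevel_eq_pow_of_source_transport` + `pullback_pullback_baseChangeTowerIso_sameDivisor`) and to `(A₀ ⊗ ℂ)^σ`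
along `e₁ ≫ T^σ` with the reindex (`weilPairingLevel_reindex_transport_eq_pow` +
`pullback_conjugateBaseChangeAlongIso_comp_conjugate_baseChangeTowerIso_sameDivisor`); all `[ℓᵏ]`-dominances on the model
are discharged in characteristic `0` (`isDominant_toSchemeHom_zsmul_of_ne_zero`).
[cite: Shimura1998, §18.6 proof of Thm. 18.6, pp. 128–130, 165, 168–169] [cite: MumfordAV1970, §20 (property (3) of e_n, p. 186)] -/
theorem weilPairingLevel_conjugate_reindex_eq_pow_of_model
    {K : Type} [Field K] [NumberField K] {Φ : CMType K} {𝔞 𝔟 𝔠 : (FractionalIdeal (𝓞 K)⁰ K)ˣ}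
    {F₀ L L₁ : Type} [Field F₀] [Field L] [Field L₁] [NumberField L₁] [Algebra F₀ L₁] [Algebra L L₁]
    [Algebra L₁ ℂ] [Algebra L ℂ] [IsScalarTower L L₁ ℂ]
    (A₀ : AbelianVariety L) (ι₀ : 𝓞 K →+* End A₀)
    -- the junction's data
    (X : CartierDivisor A₀.X.left)
    (πA : (A₀.baseChange ℂ).X.left ⟶ A₀.X.left) (hπA : πA = pullback.fst A₀.X.hom (bcSpec L ℂ)) [IsDominant πA]
    (ξ : CMTypeUniformization Φ 𝔞 (A₀.baseChange ℂ) ((endBaseChange ℂ A₀).comp ι₀))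
    (σ : ℂ ≃+* ℂ)
    (πσ : ((A₀.baseChange ℂ).conjugate σ).X.left ⟶ (A₀.baseChange ℂ).X.left)
    (hπσ : πσ = baseChangeHomFst σ.toRingHom (A₀.baseChange ℂ).X) [IsDominant πσ]
    (ℓ : ℕ) [Fact ℓ.Prime]
    [∀ k : ℕ, IsDominant (Hom.toSchemeHom (((ℓ ^ k : ℕ) : ℤ) • 𝟙 (A₀.baseChange ℂ)))]
    [∀ k : ℕ, IsDominant (Hom.toSchemeHom (((ℓ ^ k : ℕ) : ℤ) • 𝟙 ((A₀.baseChange ℂ).conjugate σ)))]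
    (ξ' : CMTypeUniformization Φ 𝔟 ((A₀.baseChange ℂ).conjugate σ)
      (((A₀.baseChange ℂ).endConjugate σ).comp ((endBaseChange ℂ A₀).comp ι₀)))
    -- the model `A₁ = A₀ ⊗_L L₁` and S5's data on it
    (γ : L₁ ≃ₐ[F₀] L₁) (hσ : ∀ x : L₁, σ (algebraMap L₁ ℂ x) = algebraMap L₁ ℂ (γ.toRingEquiv x))
    (v : HeightOneSpectrum (𝓞 L₁)) (hγ : IsArithFrobAt (𝓞 F₀) γ v.asIdeal) (R : (A₀.baseChange L₁).GoodReductionAt v)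
    (p n : ℕ) [ExpChar v.asIdeal.ResidueField p] (hq : Nat.card (𝓞 F₀ ⧸ v.asIdeal.under (𝓞 F₀)) = p ^ n)
    (Hγ : HomReduction R (R.conjFrob γ hγ p n hq))
    (κ : A₀.baseChange L₁ ⟶ (A₀.baseChange L₁).conjugate γ.toRingEquiv)
    (hκ : Hγ.redHom κ = R.reduction.relFrobenius p n)
    [IsDominant (Hom.toSchemeHom κ)] [IsDominant (Hom.toSchemeHom (Hom.baseChange ℂ κ))]
    [IsDominant (Hom.toSchemeHom (Hom.baseChange (AlgebraicClosure L₁) κ))]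
    (hℓv : ((ℓ : ℕ) : 𝓞 L₁) ∉ v.asIdeal)
    -- (G) the Galois block on `L̄₁`, at all `ℓ`-power levels
    (σ' : AlgebraicClosure L₁ ≃+* AlgebraicClosure L₁)
    (hσ' : ∀ x : L₁, σ' (algebraMap L₁ (AlgebraicClosure L₁) x) =
      algebraMap L₁ (AlgebraicClosure L₁) (γ.toRingEquiv x))
    (hσ'ζ : ∀ (k : ℕ) (ζ : AlgebraicClosure L₁), ζ ^ (ℓ ^ k) = 1 → σ' ζ = ζ ^ (p ^ n))
    (hκσ' : ∀ (k : ℕ) (x : ((A₀.baseChange L₁).baseChange (AlgebraicClosure L₁)).torsionPoints (AlgebraicClosure L₁)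
        (ℓ ^ k : ℕ)),
      AlgPoints.map (conjugateBaseChangeAlongIso γ.toRingEquiv σ' hσ' (A₀.baseChange L₁)).hom.hom.hom.hom
          (AlgPoints.map (Hom.baseChange (AlgebraicClosure L₁) κ).hom.hom.hom x.1) =
        ((A₀.baseChange L₁).baseChange (AlgebraicClosure L₁)).conjPoints σ' x.1)
    -- `ξ₁ = T⁻¹ ∘ ξ` on the model (`exists_tower_source`) and «κ ∘ ξ₁ = ξ₂» read on the junction carrier through `E`
    (ξ₁ : CMTypeUniformization Φ 𝔞 ((A₀.baseChange L₁).baseChange ℂ)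
      ((endBaseChange ℂ (A₀.baseChange L₁)).comp ((endBaseChange L₁ A₀).comp ι₀)))
    (hT : ∀ x : K, ξ.r x = AlgPoints.map (baseChangeTowerIso L L₁ ℂ A₀).hom.hom.hom.hom (ξ₁.r x))
    (ξ₂ : CMTypeUniformization Φ 𝔠 ((A₀.baseChange ℂ).conjugate σ)
      (((A₀.baseChange ℂ).endConjugate σ).comp ((endBaseChange ℂ A₀).comp ι₀)))
    (hξ₂ : ∀ u : K, ξ₂.r u =
      AlgPoints.map ((conjugateBaseChangeAlongIso γ.toRingEquiv σ hσ (A₀.baseChange L₁)).hom ≫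
            Hom.conjugate σ (baseChangeTowerIso L L₁ ℂ A₀).hom).hom.hom.hom
        (AlgPoints.map (Hom.baseChange ℂ κ).hom.hom.hom (ξ₁.r u)))
    -- the exponent as the assembly spells it (`q = N𝔭 = Ideal.absNorm 𝔭`)
    (q : ℕ) (hpq : p ^ n = q)
    -- the reindex `ξ′ = ξ₂ ∘ S(β)`, `𝔠 = β𝔟` (output of `exists_reindex_forall_conj_eq_of_torsionCongruence`)
    (β : K) (h𝔠 : (𝔠 : FractionalIdeal (𝓞 K)⁰ K) = spanSingleton (𝓞 K)⁰ β * (𝔟 : FractionalIdeal (𝓞 K)⁰ K))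
    (hξ' : ∀ w : K, ξ'.r w = ξ₂.r (β * w)) :
    ∀ (k : ℕ) (u w x y : K) (hu : ((ℓ ^ k : ℕ) : K) * u ∈ (𝔟 : FractionalIdeal (𝓞 K)⁰ K))
      (hw : ((ℓ ^ k : ℕ) : K) * w ∈ (𝔟 : FractionalIdeal (𝓞 K)⁰ K))
      (hx : ((ℓ ^ k : ℕ) : K) * x ∈ (𝔞 : FractionalIdeal (𝓞 K)⁰ K))
      (hy : ((ℓ ^ k : ℕ) : K) * y ∈ (𝔞 : FractionalIdeal (𝓞 K)⁰ K)),
      x - β * u ∈ FractionalIdeal.spanSingleton (𝓞 K)⁰ β * (𝔟 : FractionalIdeal (𝓞 K)⁰ K) →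
      y - β * w ∈ FractionalIdeal.spanSingleton (𝓞 K)⁰ β * (𝔟 : FractionalIdeal (𝓞 K)⁰ K) →
      ((A₀.baseChange ℂ).conjugate σ).weilPairingLevel ((X.pullback πA).pullback πσ)
          ⟨ξ'.r u, ξ'.r_nsmul_mem _ u hu⟩ ⟨ξ'.r w, ξ'.r_nsmul_mem _ w hw⟩ =
        ((A₀.baseChange ℂ).weilPairingLevel (X.pullback πA)
          ⟨ξ.r x, ξ.r_nsmul_mem _ x hx⟩ ⟨ξ.r y, ξ.r_nsmul_mem _ y hy⟩) ^ q := by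
  subst hpq
  intro k u w x y hu hw hx hy hxu hyw
  -- the model's uniformisation `ξ* = E⁻¹ ∘ ξ₂ = κ_ℂ ∘ ξ₁` of `(A₁^γ) ⊗ ℂ`
  obtain ⟨E, hEhom, hEeq⟩ :=
    AbelianVariety.exists_iso_conjugate_baseChange_tower (K := K) A₀ ι₀ γ.toRingEquiv σ hσ
  obtain ⟨ξs, hξs⟩ : ∃ ξs : CMTypeUniformization Φ 𝔠 (((A₀.baseChange L₁).conjugate γ.toRingEquiv).baseChange ℂ)
      ((endBaseChange ℂ ((A₀.baseChange L₁).conjugate γ.toRingEquiv)).comp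
        (((A₀.baseChange L₁).endConjugate γ.toRingEquiv).comp ((endBaseChange L₁ A₀).comp ι₀))),
      ∀ u : K, ξs.r u = AlgPoints.map E.inv.hom.hom.hom (ξ₂.r u) :=
    ⟨ξ₂.ofIso E.symm (CMTypeUniformization.comm_symm_of_comm E hEeq), fun u =>
      CMTypeUniformization.ofIso_r ξ₂ E.symm _ u⟩
  have hEinv : E.hom.hom.hom.hom ≫ E.inv.hom.hom.hom = 𝟙 _ :=
    congr_arg (fun f : ((A₀.baseChange L₁).conjugate γ.toRingEquiv).baseChange ℂ ⟶
      ((A₀.baseChange L₁).conjugate γ.toRingEquiv).baseChange ℂ => f.hom.hom.hom) E.hom_inv_id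
  have hEinv' : E.inv.hom.hom.hom ≫ E.hom.hom.hom.hom = 𝟙 _ :=
    congr_arg (fun f : (A₀.baseChange ℂ).conjugate σ ⟶ (A₀.baseChange ℂ).conjugate σ => f.hom.hom.hom) E.inv_hom_id
  have hκξ : ∀ u : K, ξs.r u = AlgPoints.map (Hom.baseChange ℂ κ).hom.hom.hom (ξ₁.r u) := fun u => by
    rw [hξs u, hξ₂ u, ← hEhom, ← AlgPoints.map_comp_apply E.hom.hom.hom.hom, hEinv, AlgPoints.map_id_apply]
  have hE : ∀ w : K, ξ'.r w = AlgPoints.map ((conjugateBaseChangeAlongIso γ.toRingEquiv σ hσ (A₀.baseChange L₁)).hom ≫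
      Hom.conjugate σ (baseChangeTowerIso L L₁ ℂ A₀).hom).hom.hom.hom (ξs.r (β * w)) := fun w => by
    rw [hξ' w, hξs, ← hEhom, ← AlgPoints.map_comp_apply E.inv.hom.hom.hom, hEinv', AlgPoints.map_id_apply]
  -- the four projections of the model and their dominance
  obtain ⟨π₁, hπ₁⟩ : ∃ π : (A₀.baseChange L₁).X.left ⟶ A₀.X.left, π = pullback.fst A₀.X.hom (bcSpec L L₁) := ⟨_, rfl⟩
  haveI : IsDominant π₁ := by rw [hπ₁]; exact A₀.isDominant_baseChangeFst L₁
  obtain ⟨πC, hπC⟩ : ∃ π : ((A₀.baseChange L₁).baseChange ℂ).X.left ⟶ (A₀.baseChange L₁).X.left,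
      π = pullback.fst (A₀.baseChange L₁).X.hom (bcSpec L₁ ℂ) := ⟨_, rfl⟩
  haveI : IsDominant πC := by rw [hπC]; exact (A₀.baseChange L₁).isDominant_baseChangeFst ℂ
  obtain ⟨πγ, hπγ⟩ : ∃ π : ((A₀.baseChange L₁).conjugate γ.toRingEquiv).X.left ⟶ (A₀.baseChange L₁).X.left,
      π = baseChangeHomFst γ.toRingEquiv.toRingHom (A₀.baseChange L₁).X := ⟨_, rfl⟩
  haveI : IsDominant πγ := by rw [hπγ]; exact isDominant_baseChangeHomFst γ.toRingEquiv (A₀.baseChange L₁)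
  obtain ⟨πB, hπB⟩ : ∃ π : (((A₀.baseChange L₁).conjugate γ.toRingEquiv).baseChange ℂ).X.left ⟶
      ((A₀.baseChange L₁).conjugate γ.toRingEquiv).X.left,
      π = pullback.fst ((A₀.baseChange L₁).conjugate γ.toRingEquiv).X.hom (bcSpec L₁ ℂ) := ⟨_, rfl⟩
  haveI : IsDominant πB := by rw [hπB]; exact ((A₀.baseChange L₁).conjugate γ.toRingEquiv).isDominant_baseChangeFst ℂ
  obtain ⟨πσC, hπσC⟩ : ∃ π : (((A₀.baseChange L₁).baseChange ℂ).conjugate σ).X.left ⟶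
      ((A₀.baseChange L₁).baseChange ℂ).X.left,
      π = baseChangeHomFst σ.toRingHom ((A₀.baseChange L₁).baseChange ℂ).X := ⟨_, rfl⟩
  haveI : IsDominant πσC := by rw [hπσC]; exact isDominant_baseChangeHomFst σ ((A₀.baseChange L₁).baseChange ℂ)
  -- `[ℓᵏ]` is dominant on the complexified model and its conjugate (characteristic 0)
  have hℓk : ∀ k : ℕ, ((ℓ ^ k : ℕ) : ℂ) ≠ 0 := fun k =>
    Nat.cast_ne_zero.2 (pow_ne_zero k (Fact.out : ℓ.Prime).ne_zero)
  haveI : ∀ k : ℕ, IsDominant (Hom.toSchemeHom (((ℓ ^ k : ℕ) : ℤ) • 𝟙 ((A₀.baseChange L₁).baseChange ℂ))) :=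
    fun k => isDominant_toSchemeHom_zsmul_of_ne_zero _ (hℓk k)
  haveI : ∀ k : ℕ, IsDominant (Hom.toSchemeHom
      (((ℓ ^ k : ℕ) : ℤ) • 𝟙 (((A₀.baseChange L₁).conjugate γ.toRingEquiv).baseChange ℂ))) :=
    fun k => isDominant_toSchemeHom_zsmul_of_ne_zero _ (hℓk k)
  -- S5 on the model, at every level `ℓᵏ`
  have hS5 : ∀ (k : ℕ) (u w : K) (hu : ((ℓ ^ k : ℕ) : K) * u ∈ (𝔞 : FractionalIdeal (𝓞 K)⁰ K))
      (hw : ((ℓ ^ k : ℕ) : K) * w ∈ (𝔞 : FractionalIdeal (𝓞 K)⁰ K))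
      (hu' : ((ℓ ^ k : ℕ) : K) * u ∈ (𝔠 : FractionalIdeal (𝓞 K)⁰ K))
      (hw' : ((ℓ ^ k : ℕ) : K) * w ∈ (𝔠 : FractionalIdeal (𝓞 K)⁰ K)),
      (((A₀.baseChange L₁).conjugate γ.toRingEquiv).baseChange ℂ).weilPairingLevel
          (((X.pullback π₁).pullback πγ).pullback πB)
          ⟨ξs.r u, ξs.r_nsmul_mem _ u hu'⟩ ⟨ξs.r w, ξs.r_nsmul_mem _ w hw'⟩ =
        (((A₀.baseChange L₁).baseChange ℂ).weilPairingLevel ((X.pullback π₁).pullback πC)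
          ⟨ξ₁.r u, ξ₁.r_nsmul_mem _ u hu⟩ ⟨ξ₁.r w, ξ₁.r_nsmul_mem _ w hw⟩) ^ (p ^ n) :=
    fun k u w hu hw hu' hw' =>
      weilPairingLevel_uniformization_conjugate_eq_pow Φ 𝔞 𝔠 (A₀.baseChange L₁) ((endBaseChange L₁ A₀).comp ι₀) γ
        v hγ R p n hq Hγ κ hκ (X.pullback π₁) πγ hπγ πC hπC πB hπB ξ₁ ξs hκξ ℓ hℓv k σ' hσ' (hσ'ζ k) (hκσ' k)
        u w hu hw hu' hw'
  -- source side: read on `A₀ ⊗ ℂ` through `T`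
  haveI : IsDominant (Hom.toSchemeHom (baseChangeTowerIso L L₁ ℂ A₀).hom) := isDominant_toSchemeHom_iso_hom _
  have hS5' := CMTypeUniformization.weilPairingLevel_eq_pow_of_source_transport ξ ξ₁ ξs
    (baseChangeTowerIso L L₁ ℂ A₀).hom (X.pullback πA) ((X.pullback π₁).pullback πC)
    (((X.pullback π₁).pullback πγ).pullback πB)
    (AbelianVariety.pullback_pullback_baseChangeTowerIso_sameDivisor A₀ X πA hπA π₁ hπ₁ πC hπC) ℓ (p ^ n) hT hS5
  -- target side: `E = e₁ ≫ T^σ` and the reindex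
  haveI : IsDominant (Hom.toSchemeHom (conjugateBaseChangeAlongIso γ.toRingEquiv σ hσ (A₀.baseChange L₁)).hom) :=
    isDominant_toSchemeHom_iso_hom _
  haveI hTσ : IsDominant (Hom.toSchemeHom (Hom.conjugate σ (baseChangeTowerIso L L₁ ℂ A₀).hom)) :=
    isDominant_toSchemeHom_iso_hom
      { hom := Hom.conjugate σ (baseChangeTowerIso L L₁ ℂ A₀).hom
        inv := Hom.conjugate σ (baseChangeTowerIso L L₁ ℂ A₀).inv
        hom_inv_id := by rw [← Hom.conjugate_comp, Iso.hom_inv_id, Hom.conjugate_id]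
        inv_hom_id := by rw [← Hom.conjugate_comp, Iso.inv_hom_id, Hom.conjugate_id] }
  haveI : IsDominant (Hom.toSchemeHom ((conjugateBaseChangeAlongIso γ.toRingEquiv σ hσ (A₀.baseChange L₁)).hom ≫
      Hom.conjugate σ (baseChangeTowerIso L L₁ ℂ A₀).hom)) := by
    rw [← hEhom]; exact isDominant_toSchemeHom_iso_hom E
  exact CMTypeUniformization.weilPairingLevel_reindex_transport_eq_pow ξ ξ' ξs
    ((conjugateBaseChangeAlongIso γ.toRingEquiv σ hσ (A₀.baseChange L₁)).hom ≫
      Hom.conjugate σ (baseChangeTowerIso L L₁ ℂ A₀).hom)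
    (X.pullback πA) ((X.pullback πA).pullback πσ) (((X.pullback π₁).pullback πγ).pullback πB)
    (AbelianVariety.pullback_conjugateBaseChangeAlongIso_comp_conjugate_baseChangeTowerIso_sameDivisor A₀ γ.toRingEquiv
      σ hσ X πA hπA π₁ hπ₁ πC hπC πσ hπσ πσC hπσC πγ hπγ πB hπB)
    ℓ (p ^ n) β h𝔠 hE hS5' k u w x y hu hw hx hy hxu hyw

end Literature.NumberTheory.ComplexMultiplication

end
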